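import Summits.ABC.ABC.Theses.IsogenyGlueCongruence
import Literature.NumberTheory.EllipticCurves.IsogenyIdProofs
import Literature.NumberTheory.EllipticCurves.IsogenyMulProofs

/-!
# `KenkuLevelFortyNine` (stmt-ABC-18226) · Negative · the hypothesis `IsCyclic` is load-bearing

Refuter crux-attack (refuter-rattack-stmt-ABC-18226-0, 2026-08-17). Sorry-free; no theorem asserts
a Theses decl positively.

The crux `KenkuLevelFortyNine` — no elliptic curve over `ℚ` admits a CYCLIC `ℚ`-isogeny of degree
`49` (`Y₀(49)(ℚ) = ∅`; Kenku 1982, Ligozat 1975; Silverman AEC IX.6 Ex. 6.4: a cyclic `ℚ`-isogeny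
has degree `≤ 19` or in `{21, 25, 27, 37, 43, 67, 163}`) — survives the cheap attacks; this file
records the kernel-checked part of the briefing:

* `kenkuLevelFortyNine_false_without_isCyclic` — with `ψ.IsCyclic` DROPPED the statement is false:
  multiplication by `7` on any elliptic curve over `ℚ` (here Cremona `49a1 = X₀(49)` itself) is a
  `ℚ`-isogeny of degree `#E[7] = 49` (`Isogeny.degree_zsmul`). Any proof must use cyclicity
  exactly to exclude the kernel `E[7] ≅ (ℤ/7)²`.
* `hypotheses_satisfiable` — the binders are inhabited with a cyclic isogeny (the identity of
  `49a1`, degree `1`), so the crux is not vacuous.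
* `not_isCyclic_zsmul_seven_of` — consistency at the near-miss: the crux implies that `[7]` is not
  cyclic (true: `E[7] ≅ (ℤ/7)²`, AEC III.6.4(b)).

## References

* M. A. Kenku, *On the number of ℚ-isomorphism classes of elliptic curves in each ℚ-isogeny class*,
  J. Number Theory 15 (1982), 199–202. [Kenku1982]
* J. H. Silverman, *The Arithmetic of Elliptic Curves*, 2nd ed., GTM 106 (2009): III.4 Ex. 4.1,
  Cor. III.6.4(b), IX.6 Example 6.4. [SilvermanAEC2009]
* J. E. Cremona, *Algorithms for Modular Elliptic Curves*, 2nd ed. (1997): §2.14 (curve 49A1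
  `y² + xy = x³ − x² − 2x − 1`), §3.8 p. 82, Table 1 (N = 49). [CremonaAlgorithms1997]
-/

-- `Summit.ABC.ABC` is the mandated summit-side namespace (CONVENTIONS §2); the duplicate is
-- deliberate.
set_option linter.dupNamespace false

noncomputable section
namespace Summit.ABC.ABC.Theorems.KenkuLevelFortyNine.Negative

open Summit.ABC.ABC.Theses.IsogenyGlueCongruence WeierstrassCurve

/-- Cremona `49a1 = X₀(49)`: `[1, -1, 0, -2, -1]`, i.e. `y² + xy = x³ − x² − 2x − 1`.
[cite: CremonaAlgorithms1997, §2.14 and Table 1, N = 49] -/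
def curve49a1 : WeierstrassCurve ℚ := ⟨1, -1, 0, -2, -1⟩

/-- `Δ(49a1) = −343 = −7³`. [cite: CremonaAlgorithms1997, Table 1, N = 49] -/
theorem curve49a1_Δ : curve49a1.Δ = -343 := by
  norm_num [curve49a1, WeierstrassCurve.Δ, b₂, b₄, b₆, b₈]

/-- `49a1` is an elliptic curve (`Δ ≠ 0`). [folklore] -/
instance curve49a1_isElliptic : curve49a1.IsElliptic := ⟨by rw [curve49a1_Δ]; norm_num⟩

/-- `KenkuLevelFortyNine` with the hypothesis `ψ.IsCyclic` DROPPED. -/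
def KenkuLevelFortyNineWithoutIsCyclic : Prop :=
  ∀ (V V' : WeierstrassCurve ℚ) [V.IsElliptic] [V'.IsElliptic] (ψ : Isogeny V V'), ψ.degree ≠ 49

/-- `deg [7] = #E[7] = 49` on every elliptic curve over `ℚ` (`Isogeny.degree_zsmul`).
[cite: SilvermanAEC2009, Cor. III.6.4(b)] -/
theorem degree_zsmul_seven (V : WeierstrassCurve ℚ) [V.IsElliptic] :
    (Isogeny.zsmul V 7 (by norm_num)).degree = 49 := by
  simpa using Isogeny.degree_zsmul V 7 (by norm_num : ((7 : ℤ) : ℚ) ≠ 0)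

/-- **`IsCyclic` is load-bearing**: without it the crux is false, witnessed by `[7]` on `49a1`
(degree `49`, kernel `E[7] ≅ (ℤ/7)²` not cyclic). [folklore] -/
theorem kenkuLevelFortyNine_false_without_isCyclic : ¬ KenkuLevelFortyNineWithoutIsCyclic :=
  fun h ↦ h curve49a1 curve49a1 (Isogeny.zsmul curve49a1 7 (by norm_num))
    (degree_zsmul_seven curve49a1)

/-- **Non-vacuity**: the binders of the crux are inhabited by a cyclic isogeny — the identity of
`49a1` (degree `1`). [folklore] -/
theorem hypotheses_satisfiable :
    ∃ (V V' : WeierstrassCurve ℚ) (_ : V.IsElliptic) (_ : V'.IsElliptic) (ψ : Isogeny V V'),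
      ψ.IsCyclic ∧ ψ.degree = 1 :=
  ⟨curve49a1, curve49a1, inferInstance, inferInstance, Isogeny.id curve49a1,
    Isogeny.isCyclic_id curve49a1, Isogeny.degree_id curve49a1⟩

/-- **Consistency at the near-miss**: the crux implies that `[7]` is not a cyclic isogeny, which is
true (`E[7] ≅ (ℤ/7)²`). [cite: SilvermanAEC2009, Cor. III.6.4(b)] -/
theorem not_isCyclic_zsmul_seven_of (h : KenkuLevelFortyNine) (V : WeierstrassCurve ℚ)
    [V.IsElliptic] : ¬ (Isogeny.zsmul V 7 (by norm_num)).IsCyclic :=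
  fun hc ↦ h V V (Isogeny.zsmul V 7 (by norm_num)) hc (degree_zsmul_seven V)

end Summit.ABC.ABC.Theorems.KenkuLevelFortyNine.Negative

end
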